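import Summits.ValiantsHypothesis.ValiantsHypothesis.Theses.FreeSubtorus
import Literature.Computability.AlgebraicComplexity.GrenetEquivariant
import Literature.Computability.AlgebraicComplexity.FermionicPencil
import Literature.LinearAlgebra.Matrix.PermanentSubperm

/-!
# `FreeSubtorus.SubtorusCovering` (stmt-ValiantsHypothesis-16134): the guard `3 ≤ n` is load-bearing,
# and exactly how much

Negative knowledge for the crux (standing disprover, cycle 1, 2026-08-17), inline statements, no new facts:

* `subtorusCovering_false_without_guard` — the crux with `3 ≤ n` dropped is FALSE, but only through the
  junk instance `n = 0`: the empty matrix is an affine, (vacuously) equivariant determinantal representation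
  of `per_0 = 1 = det ∅` of size `m = 0 < 1 = C(0,0)`.  At `n = 1, 2` the `C(n,⌊n/2⌋)`-form still holds.
* `grenetForm_false_without_guard` — the STRONGER Grenet form `2^n - 1 ≤ m · 2^r` (what the route's covering
  argument yields for `n ≥ 3` when summed over all levels; the `r = 0` case is the tree theorem
  `RigidMinimalRepsTorusBound.torusBound_proof`) is false at `n = 2` without the guard: the irregular
  `[[x₀₀, -x₁₀], [x₀₁, x₁₁]]` is a fully torus-equivariant representation of `per_2` of size `2 < 3`.
  So a proof of the strong form must use `n ≥ 3` (von zur Gathen regularity), as LR17 Thm 2.8 does.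
-/

open Literature.Computability.AlgebraicComplexity MvPolynomial Matrix

noncomputable section

namespace Summit.ValiantsHypothesis.Theorems.SubtorusCoveringNegative.Guard

/-- **The guard `3 ≤ n` is load-bearing (at `n = 0` only):** `SubtorusCovering` with the guard dropped is
false — witness `n = 0`, `m = 0`, `r = 0`, the empty matrix (`per_0 = 1 = det ∅`, equivariance vacuous on
`0 × 0` matrices), and `C(0,0) = 1 > 0 = m · 2^r`. [folklore] -/
theorem subtorusCovering_false_without_guard :
    ¬ ∀ (n m r : ℕ) (Λ : Fin r → (Fin n ⊕ Fin n) → ℤ)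
        (B : Matrix (Fin m) (Fin m) (MvPolynomial (Fin n × Fin n) ℂ)),
        (∀ i, (∑ k, Λ i (Sum.inl k)) = 0 ∧ (∑ l, Λ i (Sum.inr l)) = 0) →
        IsEquivariantDetRepr (Subgroup.closure {γ : Matrix.GeneralLinearGroup (Fin n × Fin n) ℂ |
          ∃ d e : Fin n → ℂˣ, (∀ i, (∏ k, (d k) ^ (Λ i (Sum.inl k))) * (∏ l, (e l) ^ (Λ i (Sum.inr l))) = 1) ∧
            (γ : Matrix (Fin n × Fin n) (Fin n × Fin n) ℂ) =
              Matrix.diagonal (fun p => (d p.1 : ℂ) * (e p.2 : ℂ))}) (perPoly (Fin n) ℂ) B →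
        Nat.choose n (n / 2) ≤ m * 2 ^ r := by
  intro h
  have key := h 0 0 0 (fun i => Fin.elim0 i) (Matrix.of fun i _ => Fin.elim0 i) (fun i => Fin.elim0 i)
    ⟨⟨fun i _ => Fin.elim0 i, by rw [Matrix.det_isEmpty]; simp [perPoly, Matrix.permanent_isEmpty]⟩,
      fun γ _ => ⟨1, 1, Matrix.ext fun i _ => Fin.elim0 i⟩⟩
  simp at key

/-- `per_2 = x₀₀ x₁₁ + x₁₀ x₀₁`. [folklore] -/
theorem perPoly_fin_two : perPoly (Fin 2) ℂ = X (0, 0) * X (1, 1) + X (1, 0) * X (0, 1) := by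
  rw [perPoly, Matrix.permanent_fin_two_row]
  simp only [Matrix.mvPolynomialX_apply]
  ring

/-- `[[x₀₀, -x₁₀], [x₀₁, x₁₁]]` is an affine determinantal representation of `per_2` (size `2 = dc(per_2)`;
irregular: constant part `0`). [folklore] -/
theorem isAffineDetRepr_perTwo :
    IsAffineDetRepr (perPoly (Fin 2) ℂ)
      (!![X (0, 0), -X (1, 0); X (0, 1), X (1, 1)] : Matrix (Fin 2) (Fin 2) (MvPolynomial (Fin 2 × Fin 2) ℂ)) := by
  refine ⟨fun i j => ?_, ?_⟩
  · fin_cases i <;> fin_cases j <;> simp [totalDegree_X, totalDegree_neg]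
  · rw [Matrix.det_fin_two_of, perPoly_fin_two]; ring

/-- It has exact lifts of the whole row–column torus (`g = diag e`, `h⁻¹ = diag d`), hence of every
subtorus `T_Λ`. [cite: LandsbergRessayre2017, §2.2] -/
theorem isEquivariantDetRepr_perTwo (r : ℕ) (Λ : Fin r → (Fin 2 ⊕ Fin 2) → ℤ) :
    IsEquivariantDetRepr (Subgroup.closure {γ : Matrix.GeneralLinearGroup (Fin 2 × Fin 2) ℂ |
          ∃ d e : Fin 2 → ℂˣ, (∀ i, (∏ k, (d k) ^ (Λ i (Sum.inl k))) * (∏ l, (e l) ^ (Λ i (Sum.inr l))) = 1) ∧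
            (γ : Matrix (Fin 2 × Fin 2) (Fin 2 × Fin 2) ℂ) =
              Matrix.diagonal (fun p => (d p.1 : ℂ) * (e p.2 : ℂ))}) (perPoly (Fin 2) ℂ)
      (!![X (0, 0), -X (1, 0); X (0, 1), X (1, 1)] : Matrix (Fin 2) (Fin 2) (MvPolynomial (Fin 2 × Fin 2) ℂ)) := by
  refine IsEquivariantDetRepr.of_generators isAffineDetRepr_perTwo ?_
  rintro γ ⟨d, e, -, hγ⟩
  refine ⟨Grenet.diagUnit (fun l => (e l : ℂ)) (fun l => (e l).ne_zero),
    (Grenet.diagUnit (fun k => (d k : ℂ)) (fun k => (d k).ne_zero))⁻¹, ?_⟩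
  rw [inv_inv, Grenet.val_diagUnit, Grenet.val_diagUnit, Matrix.diagonal_map (map_zero C),
    Matrix.diagonal_map (map_zero C)]
  refine Matrix.ext fun i j => ?_
  rw [Matrix.linSubstEntries_apply, Matrix.mul_diagonal, Matrix.diagonal_mul, hγ]
  fin_cases i <;> fin_cases j <;>
    simp only [Matrix.of_apply, Matrix.cons_val', Matrix.cons_val_zero, Matrix.cons_val_one,
      Matrix.empty_val', Matrix.cons_val_fin_one, map_neg,
      Grenet.linSubst_diagonal_X, MvPolynomial.smul_eq_C_mul, map_mul,
      Fin.zero_eta, Fin.mk_one, Fin.isValue] <;> ring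

/-- **The Grenet form needs the guard:** `2^n - 1 ≤ m · 2^r` for admissibly `T_Λ`-equivariant
representations of `per_n` is FALSE at `n = 2` (witness above, `r = 0`, `Λ` empty: `3 ≤ 2` fails), while the
crux's own `C(n,⌊n/2⌋)`-form survives there (`2 ≤ 2`).  What fails at `n = 2` is regularity.
[cite: LandsbergRessayre2017, Thm. 2.8] -/
theorem grenetForm_false_without_guard :
    ¬ ∀ (n m r : ℕ) (Λ : Fin r → (Fin n ⊕ Fin n) → ℤ)
        (B : Matrix (Fin m) (Fin m) (MvPolynomial (Fin n × Fin n) ℂ)),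
        (∀ i, (∑ k, Λ i (Sum.inl k)) = 0 ∧ (∑ l, Λ i (Sum.inr l)) = 0) →
        IsEquivariantDetRepr (Subgroup.closure {γ : Matrix.GeneralLinearGroup (Fin n × Fin n) ℂ |
          ∃ d e : Fin n → ℂˣ, (∀ i, (∏ k, (d k) ^ (Λ i (Sum.inl k))) * (∏ l, (e l) ^ (Λ i (Sum.inr l))) = 1) ∧
            (γ : Matrix (Fin n × Fin n) (Fin n × Fin n) ℂ) =
              Matrix.diagonal (fun p => (d p.1 : ℂ) * (e p.2 : ℂ))}) (perPoly (Fin n) ℂ) B →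
        2 ^ n - 1 ≤ m * 2 ^ r := by
  intro h
  have key := h 2 2 0 (fun i => Fin.elim0 i) _ (fun i => Fin.elim0 i) (isEquivariantDetRepr_perTwo 0 _)
  norm_num at key

end Summit.ValiantsHypothesis.Theorems.SubtorusCoveringNegative.Guard

end
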